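import Literature.Computability.Cryptography.BlumMicaliSqrt
import Literature.Computability.Complexity.MajorityVote
import HarnessLib

/-!
# The Blum–Micali reduction: coin blocks, the majority-vote selector, and the union bound

Trunk T-CRYPTO (Literature/Computability/Cryptography); groundwork for discharging the named
fact `Literature.Computability.Cryptography.blumMicali_halfPredicate_dlog` (`BlumMicali.lean`, Blum–Micali 1984, Theorem 3),
steps (a)–(c) of the plan recorded in `BlumMicaliReduction.lean`: the probabilistic analysis of
the reduction over an explicit finite space of coin tosses, down to a counting statement.

Coins. A vote consumes a *coin block* `v : Fin (k+1) → Bool`: the first `k` bits, read as a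
binary number `R < 2^k` (`Nat.ofBits`), give the shift `r = (R mod h) + 1 ∈ [1, h]`
(`h = (p-1)/2`; `bmShift`), the last bit is the tie-breaking coin (`bmCoin`). Round `t` of the
descent consumes `m` blocks `blk : Fin m → Fin (k+1) → Bool`, and a run consumes
`ω : Fin ℓ → Fin m → Fin (k+1) → Bool`. Reading `r` from bits this way is only *nearly*
uniform on `[1, h]`; instead of a statistical-distance argument we count directly: every good
pair `(r, coin)` has at least `⌊2^k / h⌋` block preimages (`card_goodBlock_ge`), which costs a
factor `(1 - h/2^k)` absorbed by taking `k ≥ |p| + |q|` (`bmGoodBlock_density`).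

Contents (all proved):

* `bmSelect` — the majority-vote square-root selector of Blum–Micali's Lemma 2 / proof of
  Theorem 3 run on coin blocks: candidate `x = bmSqrt p g e` (`BlumMicaliSqrt.lean`), `m` votes
  `bmVote` (`BlumMicaliReduction.lean`), keep `x` on a strict majority, else take `x·g^h`.
* `bmGoodBlock`, `bmFail` — a block is *good* for the residue of index `2c` if its vote about
  the candidate is right; the round *fails* if good blocks are not a strict majority.
  `bmSelect_modEq`: if the round does not fail, the selector returns the principal square root
  `g^c` (deterministic).
* `bmGoodBlock_density`: under the hypothesis of Theorem 3 (agreement `A ≥ (1/2 + 1/q)(p-1)`),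
  for `1 ≤ c`, `4cq ≤ p - 1` and `(p-1)(q+1) ≤ 2^k`, good blocks have density `≥ 1/2 + 1/(4q)`
  (Blum–Micali Lemma 2 with `ε/2`-loss for the initial segment and for reading `r` from bits).
* `card_bmFail_le`: with `m ≥ 12 ℓ q²` votes a round fails with probability `≤ 1/(3ℓ)`
  (Chebyshev, `card_majority_fail_le` of `MajorityVote.lean`; Blum–Micali Lemma 2 takes
  `m = 1/(4δε²)` trials).
* `card_filter_apply_mul_card` (product structure of `Fin ℓ → B`: the law of one coordinate) and
  `card_bmBad_le`: the union bound over the `≤ ℓ` rounds — the set of coin tables on which some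
  relevant round fails has density `≤ ℓ δ` (Blum–Micali, proof of Theorem 3: "`|p| δ`").

## References

* M. Blum, S. Micali, *How to generate cryptographically strong sequences of pseudo-random
  bits*, SIAM J. Comput. 13 (1984) 850–864, §3.3: Lemma 2 (concentrating a stochastic advantage:
  `trials(ψ, φ) = 1/(4φψ²)`, majority vote), proof of Theorem 3 (initial segment, union bound
  over the `|p|` rounds). FOCS 1982 version pp. 115–116.
* E. Kranakis, *Primality and Cryptography*, Wiley–Teubner 1986, §4.10, Thm. 4.20 (the vote,
  `P' = 4PQ²` trials) and Thm. 4.21; Thm. 3.5 (weak law of large numbers).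
-/

noncomputable section

namespace Literature.Computability.Cryptography

open Finset _root_.Computability Complexity

/-! ### Coin blocks and the majority-vote selector -/

section Select

variable {p g : ℕ}

/-- The shift read from a coin block: `r = (R mod h) + 1 ∈ [1, h]`, `h = (p-1)/2`, where `R` is
the number whose binary digits (least significant first) are the first `k` coins.
[Blum–Micali 1984, §3.3, proof of Lemma 2 ("select `r_1, …, r_{2n}` at random"), realised with
coin tosses] [cite: BlumMicali1984, §3.3 Lemma 2 (proof)] -/
def bmShift (p k : ℕ) (v : Fin (k + 1) → Bool) : ℕ :=
  Nat.ofBits (Fin.init v) % ((p - 1) / 2) + 1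

/-- The tie-breaking coin of a coin block (its last bit). [Blum–Micali 1984, §3.3, proof of
Lemma 2 (`PSQR_i` chosen "with probability 1/2")] [cite: BlumMicali1984, §3.3 Lemma 2 (proof)] -/
def bmCoin (k : ℕ) (v : Fin (k + 1) → Bool) : Bool :=
  v (Fin.last k)

/-- The vote about the candidate square root `x` cast with the coin block `v`.
[Blum–Micali 1984, §3.3, proof of Lemma 2] [cite: BlumMicali1984, §3.3 Lemma 2 (proof)] -/
def bmBlockVote (p g : ℕ) (β : ℕ → Bool) (k x : ℕ) (v : Fin (k + 1) → Bool) : Bool :=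
  bmVote p g β x (bmShift p k v) (bmCoin k v)

/-- **The majority-vote square-root selector.** On a residue `e`: candidate `x = bmSqrt p g e`;
cast the `m` votes "`x` is the principal square root" with the coin blocks `blk`; return `x` on
a strict majority, otherwise the other square root `x · g^{(p-1)/2} mod p`.
[Blum–Micali 1984, §3.3, Lemma 2 (majority of `C_X`, `C_Y`) as used in the proof of Theorem 3;
Kranakis 1986, §4.10, Thm. 4.20] [cite: BlumMicali1984, §3.3 Lemma 2] -/
def bmSelect (p g : ℕ) (β : ℕ → Bool) (m k : ℕ) (blk : Fin m → Fin (k + 1) → Bool) (e : ℕ) : ℕ :=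
  if m < 2 * (univ.filter fun j => bmBlockVote p g β k (bmSqrt p g e) (blk j) = true).card
  then bmSqrt p g e else bmSqrt p g e * g ^ ((p - 1) / 2) % p

/-- The selector returns a unit on units (whatever the votes). [folklore] -/
theorem not_dvd_bmSelect (hp : p.Prime) (hg : ¬p ∣ g) (β : ℕ → Bool) (m k : ℕ)
    (blk : Fin m → Fin (k + 1) → Bool) {e : ℕ} (he : ¬p ∣ e) :
    ¬p ∣ bmSelect p g β m k blk e := by
  haveI : Fact p.Prime := ⟨hp⟩
  have hx := not_dvd_bmSqrt hp hg he
  unfold bmSelect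
  split_ifs
  · exact hx
  · have hgz : (g : ZMod p) ≠ 0 := by rwa [Ne, ZMod.natCast_eq_zero_iff]
    have hxz : (bmSqrt p g e : ZMod p) ≠ 0 := by rwa [Ne, ZMod.natCast_eq_zero_iff]
    rw [← ZMod.natCast_eq_zero_iff, ZMod.natCast_mod, Nat.cast_mul, Nat.cast_pow]
    exact mul_ne_zero hxz (pow_ne_zero _ hgz)

/-- The right value of a vote about the candidate `x` for the residue of index `2c`: "`x` is
the principal square root `g^c`". [Blum–Micali 1984, §3.3, Lemma 2] [cite: BlumMicali1984, §3.3 Lemma 2] -/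
def bmTruth (p g c x : ℕ) : Bool :=
  decide (x ≡ g ^ c [MOD p])

/-- A coin block is *good* for the residue of index `2c` if the vote it casts about the
candidate `bmSqrt p g (g^{2c} mod p)` is right. [Blum–Micali 1984, §3.3, Lemma 2]
[cite: BlumMicali1984, §3.3 Lemma 2] -/
def bmGoodBlock (p g : ℕ) (β : ℕ → Bool) (k c : ℕ) (v : Fin (k + 1) → Bool) : Prop :=
  bmBlockVote p g β k (bmSqrt p g (g ^ (2 * c) % p)) v =
    bmTruth p g c (bmSqrt p g (g ^ (2 * c) % p))

/-- Goodness of a block is decidable (an equality of Booleans). [folklore] -/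
instance (p g : ℕ) (β : ℕ → Bool) (k c : ℕ) : DecidablePred (bmGoodBlock p g β k c) :=
  fun _ => by unfold bmGoodBlock; infer_instance

/-- The *failure event* of a round meeting the residue of index `2c`: the good blocks are not a
strict majority of the `m` blocks. [Blum–Micali 1984, §3.3, Lemma 2 (the majority errs)]
[cite: BlumMicali1984, §3.3 Lemma 2] -/
def bmFail (p g : ℕ) (β : ℕ → Bool) (m k c : ℕ) (blk : Fin m → Fin (k + 1) → Bool) : Prop :=
  2 * (univ.filter fun j => bmGoodBlock p g β k c (blk j)).card ≤ m

/-- Failure of a round is decidable (a comparison of naturals). [folklore] -/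
instance (p g : ℕ) (β : ℕ → Bool) (m k c : ℕ) : DecidablePred (bmFail p g β m k c) :=
  fun _ => by unfold bmFail; infer_instance

/-- `bmVote` only depends on the residue of the candidate. [folklore] -/
theorem bmVote_congr {β : ℕ → Bool} {x x' : ℕ} (h : x ≡ x' [MOD p]) (r : ℕ) (coin : Bool) :
    bmVote p g β x r coin = bmVote p g β x' r coin := by
  have h1 : x * g ^ r % p = x' * g ^ r % p := h.mul_right _
  have h2 : x * g ^ (r + (p - 1) / 2) % p = x' * g ^ (r + (p - 1) / 2) % p := h.mul_right _
  simp only [bmVote, h1, h2]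

/-- The residue of index `2c` is a unit and a square, and the candidate `x = bmSqrt` is one of
its two square roots `g^c`, `g^c · g^{(p-1)/2}`. [Blum–Micali 1984, §3.2 Fact 1 with §3.3
Lemma 1] [cite: BlumMicali1984, §3.2 Fact 1] -/
theorem bmSqrt_residue_cases (hg : IsDLogInstance p g 1) (hp2 : p ≠ 2) (c : ℕ) :
    bmSqrt p g (g ^ (2 * c) % p) ≡ g ^ c [MOD p] ∨
      bmSqrt p g (g ^ (2 * c) % p) ≡ g ^ c * g ^ ((p - 1) / 2) [MOD p] := by
  obtain ⟨hp, hg0, hgp, hord, -, -⟩ := hg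
  have hgu : ¬p ∣ g := fun hd => absurd (Nat.le_of_dvd hg0 hd) (not_le.2 hgp)
  haveI : Fact p.Prime := ⟨hp⟩
  have he : ¬p ∣ g ^ (2 * c) % p := by
    rw [← ZMod.natCast_eq_zero_iff, ZMod.natCast_mod, Nat.cast_pow]
    exact pow_ne_zero _ (by rwa [Ne, ZMod.natCast_eq_zero_iff])
  have hsq : ∃ x : ℕ, x ^ 2 ≡ g ^ (2 * c) % p [MOD p] :=
    ⟨g ^ c, by rw [← pow_mul, mul_comm]; exact (Nat.mod_modEq _ _).symm⟩
  have hx := (bmSqrt_sq hp hp2 hord he hsq).trans (Nat.mod_modEq _ _)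
  rw [← pow_add]
  exact (sq_modEq_pow_two_mul_iff hp hp2 hord).1 hx

/-- **The selector is right when the round does not fail** (deterministic core of Lemma 2 as
used in the proof of Theorem 3): on the residue `g^{2c} mod p` (`1 ≤ c`, `2c ≤ p - 1`), if the
good blocks are a strict majority then `bmSelect` returns the principal square root `g^c`.
[Blum–Micali 1984, §3.3, Lemma 2 and proof of Theorem 3; Kranakis 1986, §4.10, Thm. 4.20]
[cite: BlumMicali1984, §3.3 Lemma 2] -/
theorem bmSelect_modEq (hg : IsDLogInstance p g 1) (hp2 : p ≠ 2) (β : ℕ → Bool) {m k c : ℕ}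
    {blk : Fin m → Fin (k + 1) → Bool} (hgood : ¬bmFail p g β m k c blk) :
    bmSelect p g β m k blk (g ^ (2 * c) % p) ≡ g ^ c [MOD p] := by
  have hp := hg.1
  have hord := hg.2.2.2.1
  obtain ⟨k2, hk2⟩ := hp.even_sub_one hp2
  set x := bmSqrt p g (g ^ (2 * c) % p) with hxdef
  unfold bmFail at hgood
  simp only [bmGoodBlock, ← hxdef, not_le] at hgood
  unfold bmSelect
  rw [← hxdef]
  by_cases htruth : x ≡ g ^ c [MOD p]
  · -- good votes are the `true` votes: strict majority, the candidate is kept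
    have ht : bmTruth p g c x = true := by simp [bmTruth, htruth]
    rw [ht] at hgood
    rw [if_pos hgood]
    exact htruth
  · -- good votes are the `false` votes: no strict majority of `true`, the other root is taken
    have ht : bmTruth p g c x = false := by simp [bmTruth, htruth]
    rw [ht] at hgood
    have hx' : x ≡ g ^ c * g ^ ((p - 1) / 2) [MOD p] :=
      (bmSqrt_residue_cases hg hp2 c).resolve_left htruth
    have hsum := Finset.card_filter_add_card_filter_not
      (s := (univ : Finset (Fin m))) (fun j => bmBlockVote p g β k x (blk j) = true)
    simp only [card_univ, Fintype.card_fin, Bool.not_eq_true] at hsum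
    rw [if_neg (by omega)]
    refine (Nat.mod_modEq _ _).trans ((hx'.mul_right _).trans ?_)
    rw [mul_assoc, ← pow_add, ← pow_add, show (p - 1) / 2 + (p - 1) / 2 = p - 1 by omega,
      pow_add]
    conv_rhs => rw [← mul_one (g ^ c)]
    refine Nat.ModEq.mul_left _ ?_
    rw [← hord]
    have := (ZMod.natCast_eq_natCast_iff (g ^ orderOf (g : ZMod p)) 1 p).1 (by
      push_cast; exact pow_orderOf_eq_one _)
    exact this

end Select

/-! ### Density of good coin blocks (Blum–Micali Lemma 2 on coin blocks) -/

section Density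

variable {p g : ℕ}

/-- The good `(shift, coin)` pairs over the exact space `[1, h] × {0,1}`: those whose vote about
the candidate is right. [Blum–Micali 1984, §3.3, Lemma 2] [cite: BlumMicali1984, §3.3 Lemma 2] -/
def bmGoodPairs (p g : ℕ) (β : ℕ → Bool) (c : ℕ) : Finset (ℕ × Bool) :=
  (Icc 1 ((p - 1) / 2) ×ˢ (univ : Finset Bool)).filter fun rc =>
    bmVote p g β (bmSqrt p g (g ^ (2 * c) % p)) rc.1 rc.2 =
      bmTruth p g c (bmSqrt p g (g ^ (2 * c) % p))

/-- **Blum–Micali Lemma 2, exact space.** For the residue of index `2c` (`1 ≤ c`, `2c ≤ p-1`)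
the number of good pairs is at least `A - 2c`, `A` the agreement count of `β` with `B_{p,g}`
(whichever of the two square roots the candidate is). [Blum–Micali 1984, §3.3, Lemma 2 (proof);
Kranakis 1986, §4.10, Thm. 4.20, Cases 1–2] [cite: BlumMicali1984, §3.3 Lemma 2 (proof)] -/
theorem bmBitAgreement_le_card_bmGoodPairs_add (hg : IsDLogInstance p g 1) (hp2 : p ≠ 2)
    (β : ℕ → Bool) {c : ℕ} (hc1 : 1 ≤ c) (hc : 2 * c ≤ p - 1) :
    bmBitAgreement p g β ≤ (bmGoodPairs p g β c).card + 2 * c := by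
  set x := bmSqrt p g (g ^ (2 * c) % p) with hxdef
  obtain ⟨k2, hk2⟩ := hg.1.even_sub_one hp2
  unfold bmGoodPairs
  rw [← hxdef]
  by_cases htruth : x ≡ g ^ c [MOD p]
  · have ht : bmTruth p g c x = true := by simp [bmTruth, htruth]
    simp only [ht, bmVote_congr htruth]
    exact bmBitAgreement_le_card_bmVote_add hg hp2 β hc1 hc
  · have ht : bmTruth p g c x = false := by simp [bmTruth, htruth]
    have hx' : x ≡ g ^ c * g ^ ((p - 1) / 2) [MOD p] :=
      (bmSqrt_residue_cases hg hp2 c).resolve_left htruth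
    simp only [ht, bmVote_congr hx']
    have h1 := card_bmVote_nonprincipal_add_le hg hp2 β hc1 hc
    have hsum := Finset.card_filter_add_card_filter_not
      (s := Icc 1 ((p - 1) / 2) ×ˢ (univ : Finset Bool))
      (fun rc => bmVote p g β (g ^ c * g ^ ((p - 1) / 2)) rc.1 rc.2 = true)
    simp only [card_product, Nat.card_Icc, card_univ, Fintype.card_bool, Bool.not_eq_true]
      at hsum
    have : (p - 1) / 2 + 1 - 1 = (p - 1) / 2 := by omega
    rw [this] at hsum
    omega

/-- The coin block encoding a pair `(r, coin)` together with a quotient `i`: first `k` bits the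
binary digits of `r - 1 + h·i`, last bit `coin`. [folklore] -/
def bmBlockOf (p k : ℕ) (rci : (ℕ × Bool) × ℕ) : Fin (k + 1) → Bool :=
  Fin.snoc (fun u : Fin k => (rci.1.1 - 1 + (p - 1) / 2 * rci.2).testBit u) rci.1.2

/-- Reading back the shift: for `1 ≤ r ≤ h` and `r - 1 + h i < 2^k`, the block `bmBlockOf`
yields shift `r` and coin `coin`. [folklore] -/
theorem bmShift_bmBlockOf {k r i : ℕ} {coin : Bool} (hr1 : 1 ≤ r) (hrh : r ≤ (p - 1) / 2)
    (hlt : r - 1 + (p - 1) / 2 * i < 2 ^ k) :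
    bmShift p k (bmBlockOf p k ((r, coin), i)) = r ∧ bmCoin k (bmBlockOf p k ((r, coin), i)) = coin := by
  constructor
  · unfold bmShift bmBlockOf
    rw [Fin.init_snoc, Nat.ofBits_testBit, Nat.mod_eq_of_lt hlt, Nat.add_mul_mod_self_left,
      Nat.mod_eq_of_lt (by omega)]
    omega
  · unfold bmCoin bmBlockOf
    rw [Fin.snoc_last]

/-- `bmBlockOf` is injective on pairs with `1 ≤ r ≤ h` and quotients `i < ⌊2^k/h⌋`. [folklore] -/
theorem bmBlockOf_injOn (p k : ℕ) :
    Set.InjOn (bmBlockOf p k)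
      ↑((Icc 1 ((p - 1) / 2) ×ˢ (univ : Finset Bool)) ×ˢ range (2 ^ k / ((p - 1) / 2))) := by
  rintro ⟨⟨r, coin⟩, i⟩ hri ⟨⟨r', coin'⟩, i'⟩ hri' heq
  simp only [coe_product, Set.mem_prod, mem_coe, mem_Icc, Set.mem_univ, mem_range,
    coe_univ, and_true] at hri hri'
  set h := (p - 1) / 2 with hh
  have hlt : ∀ {r i : ℕ}, r ≤ h → i < 2 ^ k / h → r - 1 + h * i < 2 ^ k := by
    intro r i hr hi
    have hpos : 0 < h := Nat.pos_of_ne_zero fun h0 => by simp [h0] at hi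
    have h1 : h * i + h ≤ h * (2 ^ k / h) := by
      rw [← Nat.mul_succ]; exact Nat.mul_le_mul_left _ hi
    have h2 : h * (2 ^ k / h) ≤ 2 ^ k := Nat.mul_div_le _ _
    omega
  have e1 := bmShift_bmBlockOf (coin := coin) hri.1.1 hri.1.2 (hlt hri.1.2 hri.2)
  have e2 := bmShift_bmBlockOf (coin := coin') hri'.1.1 hri'.1.2 (hlt hri'.1.2 hri'.2)
  rw [heq] at e1
  obtain ⟨rfl, rfl⟩ : r = r' ∧ coin = coin' := ⟨e1.1.symm.trans e2.1, e1.2.symm.trans e2.2⟩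
  -- the first `k` bits determine `r - 1 + h i < 2^k`, hence `i`
  have hnum : (r - 1 + h * i) % 2 ^ k = (r - 1 + h * i') % 2 ^ k := by
    have := congrArg (fun v => Nat.ofBits (Fin.init v)) heq
    simpa only [bmBlockOf, Fin.init_snoc, Nat.ofBits_testBit] using this
  rw [Nat.mod_eq_of_lt (hlt hri.1.2 hri.2), Nat.mod_eq_of_lt (hlt hri'.1.2 hri'.2)] at hnum
  have hpos : 0 < h := Nat.pos_of_ne_zero fun h0 => by simp [h0] at hri
  have : i = i' := Nat.eq_of_mul_eq_mul_left hpos (by omega)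
  rw [this]

/-- Every good pair has at least `⌊2^k / h⌋` good block preimages: the number of good coin
blocks is at least `#(good pairs) · ⌊2^k / h⌋`. [Blum–Micali 1984, §3.3 Lemma 2, realised
with coin tosses] [folklore] -/
theorem card_goodBlock_ge (p g : ℕ) (β : ℕ → Bool) (k c : ℕ) :
    (bmGoodPairs p g β c).card * (2 ^ k / ((p - 1) / 2)) ≤
      (univ.filter (bmGoodBlock p g β k c)).card := by
  classical
  set h := (p - 1) / 2 with hh
  set S := bmGoodPairs p g β c ×ˢ range (2 ^ k / h) with hS
  have hcard : S.card = (bmGoodPairs p g β c).card * (2 ^ k / h) := by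
    rw [hS, card_product, card_range]
  rw [← hcard]
  refine card_le_card_of_injOn (bmBlockOf p k) (fun rci hrci => ?_) ?_
  · -- lands in the good blocks
    obtain ⟨⟨r, coin⟩, i⟩ := rci
    rw [hS, mem_coe, mem_product, mem_range] at hrci
    obtain ⟨hgood, hi⟩ := hrci
    unfold bmGoodPairs at hgood
    rw [mem_filter, mem_product, mem_Icc] at hgood
    obtain ⟨⟨⟨hr1, hrh⟩, -⟩, hvote⟩ := hgood
    dsimp only at hr1 hrh hvote
    have hpos : 0 < h := Nat.pos_of_ne_zero fun h0 => by simp [h0] at hi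
    have hlt : r - 1 + h * i < 2 ^ k := by
      have h1 : h * i + h ≤ h * (2 ^ k / h) := by
        rw [← Nat.mul_succ]; exact Nat.mul_le_mul_left _ hi
      have h2 : h * (2 ^ k / h) ≤ 2 ^ k := Nat.mul_div_le _ _
      omega
    obtain ⟨e1, e2⟩ := bmShift_bmBlockOf (p := p) (coin := coin) hr1 hrh hlt
    rw [mem_coe, mem_filter]
    refine ⟨mem_univ _, ?_⟩
    unfold bmGoodBlock bmBlockVote
    rw [e1, e2]
    exact hvote
  · -- injective
    refine (bmBlockOf_injOn p k).mono ?_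
    rw [hS]
    exact coe_subset.2 (product_subset_product (filter_subset _ _) subset_rfl)

/-- **Density of good coin blocks** (Blum–Micali Lemma 2 for a residue of the initial segment,
with the losses for the segment and for reading the shift from bits made explicit). Under the
hypothesis of Theorem 3 in the form `(1/2 + 1/q)(p-1) ≤ A`, for an index `2c` with `1 ≤ c` and
`4cq ≤ p - 1` (so `2c/(p-1) ≤ 1/(2q)`), and block width `k` with `(p-1)(q+1) ≤ 2^k`, at least a
`1/2 + 1/(4q)` fraction of the coin blocks is good. [Blum–Micali 1984, §3.3, Lemma 2 (a vote is
right with probability `≥ 1/2 + ε - 1/n`); Kranakis 1986, §4.10, Thm. 4.20]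
[cite: BlumMicali1984, §3.3 Lemma 2] -/
theorem bmGoodBlock_density (hg : IsDLogInstance p g 1) (hp2 : p ≠ 2) (β : ℕ → Bool)
    {k c q : ℕ} (hq : 1 ≤ q) (hc1 : 1 ≤ c) (hcq : 4 * c * q ≤ p - 1)
    (hk : (p - 1) * (q + 1) ≤ 2 ^ k)
    (hA : (1 / 2 + 1 / q) * ((p - 1 : ℕ) : ℝ) ≤ bmBitAgreement p g β) :
    (1 / 2 + 1 / (4 * q)) * (Fintype.card (Fin (k + 1) → Bool) : ℝ) ≤
      (univ.filter (bmGoodBlock p g β k c)).card := by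
  obtain ⟨k2, hk2⟩ := hg.1.even_sub_one hp2
  set h := (p - 1) / 2 with hh
  have hph : p - 1 = 2 * h := by omega
  have hc : 2 * c ≤ p - 1 := le_trans (by nlinarith) hcq
  -- naturals: the counts
  have hGS := bmBitAgreement_le_card_bmGoodPairs_add hg hp2 β hc1 hc
  have hGB := card_goodBlock_ge p g β k c
  rw [← hh] at hGB
  set D := 2 ^ k / h with hD
  have hpos : 0 < h := by
    have : 4 ≤ p - 1 := le_trans (by nlinarith) hcq
    omega
  have hDh : 2 ^ k < h * D + h := by
    rw [hD]; have := Nat.div_add_mod (2 ^ k) h; have := Nat.mod_lt (2 ^ k) hpos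
    nlinarith [Nat.div_add_mod (2 ^ k) h]
  have hcardV : Fintype.card (Fin (k + 1) → Bool) = 2 * 2 ^ k := by
    rw [Fintype.card_fun, Fintype.card_bool, Fintype.card_fin, pow_succ, mul_comm]
  -- reals
  rw [hcardV]
  set G := ((bmGoodPairs p g β c).card : ℝ) with hG
  set A := (bmBitAgreement p g β : ℝ) with hAdef
  have hq' : (0 : ℝ) < q := by exact_mod_cast hq
  have hH : (0 : ℝ) < h := by exact_mod_cast hpos
  have hp1 : ((p - 1 : ℕ) : ℝ) = 2 * h := by rw [hph]; push_cast; ring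
  rw [hp1] at hA
  have hGS' : A - 2 * c ≤ G := by
    have : (bmBitAgreement p g β : ℝ) ≤ (bmGoodPairs p g β c).card + 2 * c := by
      exact_mod_cast hGS
    linarith
  have hcq' : (2 * c : ℝ) * (2 * q) ≤ 2 * h := by
    have : ((4 * c * q : ℕ) : ℝ) ≤ ((p - 1 : ℕ) : ℝ) := by exact_mod_cast hcq
    rw [hp1] at this; push_cast at this; linarith
  have hDh' : (2 : ℝ) ^ k ≤ h * D + h := by
    have : ((2 ^ k : ℕ) : ℝ) ≤ ((h * D + h : ℕ) : ℝ) := by exact_mod_cast hDh.le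
    push_cast at this; exact this
  have hk' : (2 * h : ℝ) * (q + 1) ≤ (2 : ℝ) ^ k := by
    have : (((p - 1) * (q + 1) : ℕ) : ℝ) ≤ ((2 ^ k : ℕ) : ℝ) := by exact_mod_cast hk
    rw [Nat.cast_mul, hp1] at this; push_cast at this; exact this
  have hGB' : G * D ≤ ((univ.filter (bmGoodBlock p g β k c)).card : ℝ) := by
    have : (((bmGoodPairs p g β c).card * D : ℕ) : ℝ) ≤
        ((univ.filter (bmGoodBlock p g β k c)).card : ℝ) := by exact_mod_cast hGB
    push_cast at this; exact this
  have hDnn : (0 : ℝ) ≤ D := by positivity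
  -- `2c ≤ h/q`, so `G ≥ h + h/q = h (1 + 1/q)`
  have hc2 : (2 * c : ℝ) ≤ h / q := by
    rw [le_div_iff₀ hq']; linarith
  have hG1 : h * (1 + 1 / q) ≤ G := by
    have : A ≥ (1 / 2 + 1 / q) * (2 * h) := hA
    have e : (1 / 2 + 1 / q) * (2 * (h : ℝ)) = h + 2 * (h / q) := by ring
    have e2 : (h : ℝ) * (1 + 1 / q) = h + h / q := by ring
    linarith
  -- `G · D ≥ (1 + 1/q) (h D) ≥ (1 + 1/q) (2^k - h)`
  have hstep : (1 + 1 / q) * ((2 : ℝ) ^ k - h) ≤ G * D := by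
    have h1 : h * (1 + 1 / q) * D ≤ G * D := mul_le_mul_of_nonneg_right hG1 hDnn
    have h2 : (1 + 1 / q) * ((2 : ℝ) ^ k - h) ≤ (1 + 1 / q) * (h * D) :=
      mul_le_mul_of_nonneg_left (by linarith) (by positivity)
    linarith
  -- and `(1 + 1/q)(2^k - h) ≥ (1/2 + 1/(4q)) · 2 · 2^k` iff `2^k ≥ 2h(q+1)`
  have hfinal : (1 / 2 + 1 / (4 * q)) * ((2 * 2 ^ k : ℕ) : ℝ) ≤ (1 + 1 / q) * ((2 : ℝ) ^ k - h) := by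
    push_cast
    -- multiply the claim by `q > 0`
    have e1 : (q : ℝ) * ((1 / 2 + 1 / (4 * q)) * (2 * (2 : ℝ) ^ k)) = q * 2 ^ k + 2 ^ k / 2 := by
      field_simp; ring
    have e2 : (q : ℝ) * ((1 + 1 / q) * ((2 : ℝ) ^ k - h)) = (q + 1) * 2 ^ k - (q + 1) * h := by
      field_simp
    have key : (q : ℝ) * ((1 / 2 + 1 / (4 * q)) * (2 * (2 : ℝ) ^ k)) ≤
        q * ((1 + 1 / q) * ((2 : ℝ) ^ k - h)) := by
      rw [e1, e2]
      nlinarith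
    exact le_of_mul_le_mul_left key hq'
  linarith

end Density

/-! ### The failure probability of one round (Chebyshev) -/

section Fail

variable {p g : ℕ}

/-- **Blum–Micali Lemma 2 (concentrating a stochastic advantage), one round.** With
`m ≥ 12 ℓ q²` independent votes each right with probability `≥ 1/2 + 1/(4q)`, the majority is
wrong with probability `≤ 1/(3ℓ)`: the failure event has at most a `1/(3ℓ)` fraction of the
coin-block tables `Fin m → (Fin (k+1) → Bool)`. (Blum–Micali: `trials(ψ, φ) = 1/(4φψ²)` with
`ψ = 1/(4q)`, `φ = 1/(3ℓ)`.) [Blum–Micali 1984, §3.3, Lemma 2; Kranakis 1986, §4.10, Thm. 4.20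
(`P' = 4PQ²`)] [cite: BlumMicali1984, §3.3 Lemma 2] -/
theorem card_bmFail_le (hg : IsDLogInstance p g 1) (hp2 : p ≠ 2) (β : ℕ → Bool)
    {m k c q ℓ : ℕ} (hq : 1 ≤ q) (hℓ : 1 ≤ ℓ) (hc1 : 1 ≤ c) (hcq : 4 * c * q ≤ p - 1)
    (hk : (p - 1) * (q + 1) ≤ 2 ^ k) (hm : 12 * ℓ * q ^ 2 ≤ m)
    (hA : (1 / 2 + 1 / q) * ((p - 1 : ℕ) : ℝ) ≤ bmBitAgreement p g β) :
    ((univ.filter (bmFail p g β m k c)).card : ℝ) ≤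
      1 / (3 * ℓ) * Fintype.card (Fin m → Fin (k + 1) → Bool) := by
  have hq' : (0 : ℝ) < q := by exact_mod_cast hq
  have hℓ' : (0 : ℝ) < ℓ := by exact_mod_cast hℓ
  have hη : (0 : ℝ) < 1 / (4 * q) := by positivity
  have hδ : (0 : ℝ) < 1 / (3 * ℓ) := by positivity
  have hm' : 1 / (4 * (1 / (3 * (ℓ : ℝ))) * (1 / (4 * q)) ^ 2) ≤ m := by
    have e : 1 / (4 * (1 / (3 * (ℓ : ℝ))) * (1 / (4 * q)) ^ 2) = 12 * ℓ * q ^ 2 := by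
      field_simp; ring
    rw [e]; exact_mod_cast hm
  have hgood := bmGoodBlock_density hg hp2 β hq hc1 hcq hk hA
  exact card_majority_fail_le (bmGoodBlock p g β k c) hη hδ hm' hgood

end Fail

/-! ### Product structure and the union bound over the rounds -/

section Union

/-- **Counting through a product decomposition.** If `e : Ω ≃ B × C`, the number of `ω` whose
first coordinate satisfies `P` is `#{b | P b} · |C|` (all fibres of the first coordinate have
size `|C|`). (Product of uniform distributions.) [folklore] -/
theorem card_filter_fst_equiv {Ω B C : Type*} [Fintype Ω] [Fintype B] [Fintype C]
    (e : Ω ≃ B × C) (P : B → Prop) [DecidablePred P] :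
    (univ.filter fun ω => P (e ω).1).card = (univ.filter P).card * Fintype.card C := by
  classical
  rw [← Fintype.card_subtype, ← Fintype.card_subtype, ← Fintype.card_prod]
  refine Fintype.card_congr
    ((e.subtypeEquiv (p := fun ω => P (e ω).1) (q := fun x => P x.1) fun ω => Iff.rfl).trans ?_)
  exact
    { toFun := fun x => (⟨x.1.1, x.2⟩, x.1.2)
      invFun := fun y => ⟨(y.1.1, y.2), y.1.2⟩
      left_inv := fun _ => rfl
      right_inv := fun _ => rfl }

/-- **The law of one coordinate of a uniform table.** For `ω` uniform on `ι → B`, the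
coordinate `ω t` is uniform on `B`: `#{ω | P (ω t)} · |B| = #{b | P b} · |ι → B|`.
(Product of uniform distributions.) [folklore] -/
theorem card_filter_apply_mul_card {ι B : Type*} [Fintype ι] [DecidableEq ι] [Fintype B]
    (t : ι) (P : B → Prop) [DecidablePred P] :
    (univ.filter fun ω : ι → B => P (ω t)).card * Fintype.card B =
      (univ.filter P).card * Fintype.card (ι → B) := by
  classical
  have h1 := card_filter_fst_equiv (Equiv.funSplitAt t B) P
  have h2 : Fintype.card (ι → B) = Fintype.card B * Fintype.card ({j // j ≠ t} → B) := by
    rw [← Fintype.card_prod]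
    exact Fintype.card_congr (Equiv.funSplitAt t B)
  have h3 : (univ.filter fun ω : ι → B => P (ω t)) =
      univ.filter fun ω => P ((Equiv.funSplitAt t B ω).1) :=
    Finset.filter_congr fun ω _ => by rw [Equiv.funSplitAt_apply]
  rw [h3, h1, h2]
  ring

/-- The law of one coordinate, as an inequality of densities: if `P` has density `≤ δ` on `B`
then `{ω | P (ω t)}` has density `≤ δ` on `ι → B`. [folklore] -/
theorem card_filter_apply_le {ι B : Type*} [Fintype ι] [DecidableEq ι] [Fintype B] [Nonempty B]
    (t : ι) (P : B → Prop) [DecidablePred P] {δ : ℝ}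
    (h : ((univ.filter P).card : ℝ) ≤ δ * Fintype.card B) :
    ((univ.filter fun ω : ι → B => P (ω t)).card : ℝ) ≤ δ * Fintype.card (ι → B) := by
  have hmul := card_filter_apply_mul_card t P
  have hB : (0 : ℝ) < Fintype.card B := by exact_mod_cast Fintype.card_pos
  have hmul' : ((univ.filter fun ω : ι → B => P (ω t)).card : ℝ) * Fintype.card B =
      (univ.filter P).card * Fintype.card (ι → B) := by exact_mod_cast hmul
  have hΩ : (0 : ℝ) ≤ Fintype.card (ι → B) := by positivity
  nlinarith [mul_le_mul_of_nonneg_right h hΩ]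

/-- **The union bound over the rounds** (Blum–Micali, proof of Theorem 3: "the probability
that … at least one wrong bit is `≤ |p| δ`"). If, for every relevant round `t` (those with
`rel t`), the failure event `F t` has density `≤ δ` on the round's coin tables `B`, then any
event `Bad` on coin tables `ω : ι → B` implying that some relevant round fails has density
`≤ |ι| δ`.
[Blum–Micali 1984, §3.3, proof of Theorem 3; Kranakis 1986, §4.10, Thm. 4.21]
[cite: BlumMicali1984, Theorem 3 (proof)] -/
theorem card_filter_exists_apply_le {ι B : Type*} [Fintype ι] [DecidableEq ι] [Fintype B]
    [Nonempty B] (rel : ι → Prop) (F : ι → B → Prop) [∀ t, DecidablePred (F t)] {δ : ℝ}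
    (hδ : 0 ≤ δ) (h : ∀ t, rel t → ((univ.filter (F t)).card : ℝ) ≤ δ * Fintype.card B)
    (Bad : (ι → B) → Prop) [DecidablePred Bad] (hBad : ∀ ω, Bad ω → ∃ t, rel t ∧ F t (ω t)) :
    ((univ.filter Bad).card : ℝ) ≤ Fintype.card ι * δ * Fintype.card (ι → B) := by
  classical
  -- only the relevant rounds contribute
  let G : ι → Finset (ι → B) := fun t =>
    if rel t then univ.filter fun ω : ι → B => F t (ω t) else ∅
  have hsub : univ.filter Bad ⊆ (univ : Finset ι).biUnion G := by
    intro ω hω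
    rw [mem_filter] at hω
    obtain ⟨t, ht, hF⟩ := hBad ω hω.2
    rw [mem_biUnion]
    refine ⟨t, mem_univ _, ?_⟩
    simp only [G, if_pos ht, mem_filter, mem_univ, true_and]
    exact hF
  have hle := (card_le_card hsub).trans card_biUnion_le
  have hle' : ((univ.filter Bad).card : ℝ) ≤ ∑ t : ι, ((G t).card : ℝ) := by
    exact_mod_cast hle
  refine hle'.trans ?_
  have hterm : ∀ t : ι, ((G t).card : ℝ) ≤ δ * Fintype.card (ι → B) := by
    intro t
    by_cases ht : rel t
    · simp only [G, if_pos ht]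
      exact card_filter_apply_le t (F t) (h t ht)
    · simp only [G, if_neg ht, card_empty, Nat.cast_zero]
      positivity
  calc ∑ t : ι, ((G t).card : ℝ)
      ≤ ∑ _t : ι, δ * Fintype.card (ι → B) := sum_le_sum fun t _ => hterm t
    _ = Fintype.card ι * δ * Fintype.card (ι → B) := by
      rw [sum_const, card_univ, nsmul_eq_mul]; ring

end Union

/-! ### The coin tables of a run of the reduction -/

section Run

variable {p g : ℕ}

/-- The residue index met in round `t` of the descent from an element of index `a'`:
`c_t = ⌊a' / 2^{t+1}⌋` (round `t` asks the selector about `g^{2 c_t}` when `c_t ≥ 1`).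
[Blum–Micali 1984, §3.3, proof of Lemma 1] [cite: BlumMicali1984, §3.3 Lemma 1 (proof)] -/
def bmRoundIndex (a' t : ℕ) : ℕ :=
  a' / 2 ^ (t + 1)

/-- The *bad* coin tables for the descent from an element of index `a'`: some round `t < ℓ`
meeting a residue of index `2c_t ≥ 2` fails. [Blum–Micali 1984, §3.3, proof of Theorem 3]
[cite: BlumMicali1984, Theorem 3 (proof)] -/
def bmBad (p g : ℕ) (β : ℕ → Bool) (ℓ m k a' : ℕ) (ω : Fin ℓ → Fin m → Fin (k + 1) → Bool) :
    Prop :=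
  ∃ t : Fin ℓ, 1 ≤ bmRoundIndex a' t ∧ bmFail p g β m k (bmRoundIndex a' t) (ω t)

/-- Badness of a coin table is decidable (finitely many rounds). [folklore] -/
instance (p g : ℕ) (β : ℕ → Bool) (ℓ m k a' : ℕ) : DecidablePred (bmBad p g β ℓ m k a') :=
  fun _ => by unfold bmBad; infer_instance

/-- The round-indexed selector family read off a coin table: round `i < ℓ` votes with the
blocks `ω i`; rounds `i ≥ ℓ` (never run) return their argument. [Blum–Micali 1984, §3.3,
proof of Theorem 3] [cite: BlumMicali1984, Theorem 3 (proof)] -/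
def bmSelFamily (p g : ℕ) (β : ℕ → Bool) (ℓ m k : ℕ) (ω : Fin ℓ → Fin m → Fin (k + 1) → Bool)
    (i e : ℕ) : ℕ :=
  if h : i < ℓ then bmSelect p g β m k (ω ⟨i, h⟩) e else e

/-- The selector family maps units to units. [folklore] -/
theorem not_dvd_bmSelFamily (hp : p.Prime) (hg : ¬p ∣ g) (β : ℕ → Bool) (ℓ m k : ℕ)
    (ω : Fin ℓ → Fin m → Fin (k + 1) → Bool) (i : ℕ) {e : ℕ} (he : ¬p ∣ e) :
    ¬p ∣ bmSelFamily p g β ℓ m k ω i e := by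
  unfold bmSelFamily
  split_ifs
  · exact not_dvd_bmSelect hp hg β m k _ he
  · exact he

/-- **Off the bad set every relevant selector call is right**: for a coin table outside
`bmBad … a'`, the selector family satisfies `BMSelCorrectAt` at every round `t < ℓ` of the
descent from an element of index `a' < L` with `2q(L-1) ≤ p - 1`... precisely, whenever
`4 c_t q ≤ p - 1` is not even needed: correctness only uses non-failure. [Blum–Micali 1984,
§3.3, proof of Theorem 3] [cite: BlumMicali1984, Theorem 3 (proof)] -/
theorem bmSelCorrectAt_of_not_bad (hg : IsDLogInstance p g 1) (hp2 : p ≠ 2) (β : ℕ → Bool)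
    {ℓ m k a' : ℕ} {ω : Fin ℓ → Fin m → Fin (k + 1) → Bool} (hω : ¬bmBad p g β ℓ m k a' ω)
    {t : ℕ} (ht : t < ℓ) : BMSelCorrectAt p g (bmSelFamily p g β ℓ m k ω) a' t := by
  intro hc1
  have hnf : ¬bmFail p g β m k (bmRoundIndex a' t) (ω ⟨t, ht⟩) := fun hf => hω ⟨⟨t, ht⟩, hc1, hf⟩
  unfold bmSelFamily
  rw [dif_pos ht]
  exact bmSelect_modEq hg hp2 β hnf

/-- **The bad set is small.** Under the hypothesis of Theorem 3 (`(1/2 + 1/q)(p-1) ≤ A`), for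
an element of index `a'` with `2 a' q ≤ p - 1` (the initial segment), block width `k` with
`(p-1)(q+1) ≤ 2^k` and `m ≥ 12 ℓ q²` votes, at most a third of the coin tables are bad.
[Blum–Micali 1984, §3.3, proof of Theorem 3 (`n = 2Q`, `δ = 1/(3|p|)`… here `ℓδ = 1/3`);
Kranakis 1986, §4.10, Thm. 4.21] [cite: BlumMicali1984, Theorem 3 (proof)] -/
theorem card_bmBad_le (hg : IsDLogInstance p g 1) (hp2 : p ≠ 2) (β : ℕ → Bool)
    {ℓ m k q a' : ℕ} (hq : 1 ≤ q) (hℓ : 1 ≤ ℓ) (ha' : 2 * a' * q ≤ p - 1)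
    (hk : (p - 1) * (q + 1) ≤ 2 ^ k) (hm : 12 * ℓ * q ^ 2 ≤ m)
    (hA : (1 / 2 + 1 / q) * ((p - 1 : ℕ) : ℝ) ≤ bmBitAgreement p g β) :
    3 * ((univ.filter (bmBad p g β ℓ m k a')).card : ℝ) ≤
      Fintype.card (Fin ℓ → Fin m → Fin (k + 1) → Bool) := by
  have hℓ' : (0 : ℝ) < ℓ := by exact_mod_cast hℓ
  have hround : ∀ t : Fin ℓ, 1 ≤ bmRoundIndex a' t →
      ((univ.filter (bmFail p g β m k (bmRoundIndex a' t))).card : ℝ) ≤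
        1 / (3 * ℓ) * Fintype.card (Fin m → Fin (k + 1) → Bool) := by
    intro t hc1
    refine card_bmFail_le hg hp2 β hq hℓ hc1 ?_ hk hm hA
    -- `4 c_t q ≤ 2 a' q ≤ p - 1` since `2 c_t ≤ a' / 2^t ≤ a'`
    have h1 : 2 * bmRoundIndex a' t ≤ a' := by
      unfold bmRoundIndex
      calc 2 * (a' / 2 ^ ((t : ℕ) + 1)) = 2 * (a' / 2 ^ (t : ℕ) / 2) := by
            rw [pow_succ, ← Nat.div_div_eq_div_mul]
        _ ≤ a' / 2 ^ (t : ℕ) := Nat.mul_div_le _ _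
        _ ≤ a' := Nat.div_le_self _ _
    calc 4 * bmRoundIndex a' t * q = 2 * (2 * bmRoundIndex a' t) * q := by ring
      _ ≤ 2 * a' * q := by gcongr
      _ ≤ p - 1 := ha'
  have hunion := card_filter_exists_apply_le (fun t : Fin ℓ => 1 ≤ bmRoundIndex a' t)
    (fun t => bmFail p g β m k (bmRoundIndex a' t)) (δ := 1 / (3 * ℓ)) (by positivity) hround
    (bmBad p g β ℓ m k a') (fun ω hω => hω)
  rw [Fintype.card_fin] at hunion
  have e : (ℓ : ℝ) * (1 / (3 * ℓ)) = 1 / 3 := by field_simp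
  rw [e] at hunion
  linarith

end Run

end Literature.Computability.Cryptography

end
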